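import Literature.Analysis.ODE.ConstantEnclosure
import Literature.Analysis.ODE.TaylorEnclosure
import Literature.Analysis.ODE.LipschitzFlow
import HarnessLib

/-!
# The high-order (Taylor) a priori enclosure test of validated ODE integration

Topic `Literature/Analysis/ODE`. The ORDER-`K` A PRIORI ENCLOSURE TEST ("high-order enclosure",
HOE) of interval Taylor-series integrators (Nedialkov–Jackson–Pryce 2001, after Corliss–Rihm 1996;
the order-1 case is Moore's constant enclosure test of `ConstantEnclosure.lean`). Let
`f : ℝⁿ → ℝⁿ` be an autonomous field with TAYLOR COEFFICIENT FUNCTIONS `Φ j = f^[j]`: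
`Φ 0 = id`, and on an open set `Ω` each `Φ j` (`j < K`) is differentiable with derivative `Φ' j`
satisfying the recursion `Φ' j x (f x) = (j+1) • Φ (j+1) x` (i.e. `f^[j+1] = (j+1)⁻¹ (∂f^[j]/∂y) f`,
so that along any solution `y⁽ʲ⁾(t) = j! • Φ j (y t)`; in particular `Φ 1 = f` on `Ω`). Let
`S ⊆ Ω` be the candidate a priori enclosure (a box), `‖Φ' j x‖ ≤ B` on `S` for `j < K`, `Φ K`
Lipschitz on `S` with `Φ K (S) ⊆ [c, d]` (the interval evaluation `f^[K](S)`), `h ≥ 0`, and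
suppose the TEST

  `∑_{j<K} t^j • Φ j y₀ + t^K • v ∈ S` for all `t ∈ [0, h]`, `v ∈ [c, d]`

(the verifier's `U + [0,h]^K f^[K](S) ⊆ S`, `U = y₀ + ∑_{1≤j<K} [0,h]^j f^[j](y₀)`). THEN
(`exists_solution_of_highOrderEnclosure`) a solution of `y' = f(y)`, `y(0) = y₀` exists on the
whole step `[0, h]` and satisfies `y t = ∑_{j<K} t^j • Φ j y₀ + t^K • v_t` with `v_t ∈ [c, d]`, in
particular `y t ∈ S`; if `f` is Lipschitz on bounded sets, EVERY solution on `[0, h]` from `y₀`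
is so enclosed (`solution_mem_of_highOrderEnclosure`); `highOrderEnclosure_step` is the form for
a box `W` of initial values. This is the statement "by the standard Taylor-model argument this
proves every solution starting in `X_k` exists on `[t_k, t_k + h_k]` and stays in `Y_k`" behind
step validation in validated ODE solvers (VNODE's HOE; CAPD's high-order rough enclosure).

Proof (no fixed-point theorem in function space is needed): (A) extend `Φ K|S` to a globally
Lipschitz `G : ℝⁿ → [c, d]` (McShane + clamping, as in `ConstantEnclosure.lean`); (B) solve the
`K`-th order equation `u⁽ᴷ⁾ = K! • G(u)` with jets `u⁽ʲ⁾(0) = j! • Φ j y₀` globally (a Lipschitz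
first-order system on `(Fin K → ℝⁿ)`, `LipschitzFlow.lean`); (C) by the set-valued Taylor
enclosure `taylorCoeff_enclosure` (`TaylorEnclosure.lean`), `u t ∈ ∑ t^j Φ j y₀ + t^K [c, d] ⊆ S`
on `[0, h]`; (D) the jet errors `e j = u⁽ʲ⁾ - j! • Φ j (u)` (`1 ≤ j < K`) vanish at `0`, `e K ≡ 0`
on `[0, h]` (there `G = Φ K`), and satisfy the linear system
`e j' = e (j+1) - j! • Φ' j (u) (e 1)`; Grönwall gives `e ≡ 0`, so `u' = Φ 1 (u) = f(u)`.
(E) Uniqueness for locally Lipschitz `f` transfers the enclosure to every solution.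

## References

* N. S. Nedialkov, K. R. Jackson, J. D. Pryce, *An effective high-order interval method for
  validating existence and uniqueness of the solution of an IVP for an ODE*, Reliable Computing 7
  (2001) 449–465, §3 (the HOE existence test). [NedialkovJacksonPryce2001]
* N. S. Nedialkov, K. R. Jackson, G. F. Corliss, *Validated solutions of initial value problems
  for ordinary differential equations*, Appl. Math. Comput. 105 (1999) 21–68 (Taylor coefficients
  `f^[j]`, Algorithm I). [NedialkovJacksonCorliss1999]
* R. E. Moore, *Methods and Applications of Interval Analysis* (SIAM 1979), §8.1. [Moore1979]
-/

noncomputable section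

open Set Metric Filter Topology

open scoped NNReal Nat

namespace Literature.Analysis.ODE

section KthOrder

variable {E : Type*} [NormedAddCommGroup E] [NormedSpace ℝ E] [CompleteSpace E]

/-- `K`-th order validated existence: for a globally Lipschitz `G : E → E`, `K ≥ 1` and
prescribed jets `a i` (`i < K`) there is a derivative chain `D` on `[0, ∞)` with `D i 0 = a i`
(`i < K`), `D (i+1)` the right derivative of `D i`, and `D K t = K! • G (D 0 t)`: the `K`-th order
equation `u⁽ᴷ⁾ = K! G(u)` written as a first-order system on `Fin K → E`. [folklore] -/
private theorem exists_chain_of_lipschitz {G : E → E} {L : ℝ≥0} (hG : LipschitzWith L G) {K : ℕ}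
    (hK : 0 < K) (a : ℕ → E) :
    ∃ D : ℕ → ℝ → E, (∀ i < K, D i 0 = a i) ∧
      (∀ i < K, ∀ t, 0 ≤ t → HasDerivWithinAt (D i) (D (i + 1) t) (Ici 0) t) ∧
      ∀ t, D K t = (K ! : ℝ) • G (D 0 t) := by
  set V : (Fin K → E) → (Fin K → E) := fun w i =>
    if h : (i : ℕ) + 1 < K then w ⟨i + 1, h⟩ else (K ! : ℝ) • G (w ⟨0, hK⟩) with hV
  have hGK : LipschitzWith ((K ! : ℝ≥0) * L) (fun x => (K ! : ℝ) • G x) := by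
    refine LipschitzWith.of_dist_le_mul fun x y => ?_
    rw [dist_smul₀, NNReal.coe_mul, NNReal.coe_natCast, Real.norm_of_nonneg (by positivity),
      mul_assoc]
    exact mul_le_mul_of_nonneg_left (hG.dist_le_mul x y) (by positivity)
  have hVlip : LipschitzWith (max 1 ((K ! : ℝ≥0) * L)) V := by
    refine LipschitzWith.of_dist_le_mul fun w w' => (dist_pi_le_iff (by positivity)).2 fun i => ?_
    have hmax : (1 : ℝ) ≤ ((max 1 ((K ! : ℝ≥0) * L) : ℝ≥0) : ℝ) := by
      exact_mod_cast le_max_left _ _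
    have hmax' : (((K ! : ℝ≥0) * L : ℝ≥0) : ℝ) ≤ ((max 1 ((K ! : ℝ≥0) * L) : ℝ≥0) : ℝ) := by
      exact_mod_cast le_max_right _ _
    by_cases h : (i : ℕ) + 1 < K
    · simp only [hV, dif_pos h]
      calc dist (w ⟨i + 1, h⟩) (w' ⟨i + 1, h⟩) ≤ dist w w' := dist_le_pi_dist w w' _
        _ ≤ _ := le_mul_of_one_le_left dist_nonneg hmax
    · simp only [hV, dif_neg h]
      calc dist ((K ! : ℝ) • G (w ⟨0, hK⟩)) ((K ! : ℝ) • G (w' ⟨0, hK⟩))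
          ≤ (((K ! : ℝ≥0) * L : ℝ≥0) : ℝ) * dist (w ⟨0, hK⟩) (w' ⟨0, hK⟩) :=
            hGK.dist_le_mul _ _
        _ ≤ (((K ! : ℝ≥0) * L : ℝ≥0) : ℝ) * dist w w' :=
            mul_le_mul_of_nonneg_left (dist_le_pi_dist w w' _) (NNReal.coe_nonneg _)
        _ ≤ _ := mul_le_mul_of_nonneg_right hmax' dist_nonneg
  obtain ⟨W, hW0, hW, -⟩ := exists_solution_Ici_of_lipschitz hVlip (fun i : Fin K => a i)
  refine ⟨fun i t => if h : i < K then W t ⟨i, h⟩ else (K ! : ℝ) • G (W t ⟨0, hK⟩), ?_, ?_, ?_⟩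
  · intro i hi
    simp only [dif_pos hi, hW0]
  · intro i hi t ht
    have hcomp := (hasDerivWithinAt_pi.1 (hW t ht)) ⟨i, hi⟩
    simp only [dif_pos hi]
    by_cases h : i + 1 < K
    · have hVi : V (W t) ⟨i, hi⟩ = W t ⟨i + 1, h⟩ := by
        simp only [hV]
        rw [dif_pos (show ((⟨i, hi⟩ : Fin K) : ℕ) + 1 < K from h)]
      rw [dif_pos h, ← hVi]
      exact hcomp
    · have hVi : V (W t) ⟨i, hi⟩ = (K ! : ℝ) • G (W t ⟨0, hK⟩) := by
        simp only [hV]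
        rw [dif_neg (show ¬ ((⟨i, hi⟩ : Fin K) : ℕ) + 1 < K from h)]
      rw [dif_neg h, ← hVi]
      exact hcomp
  · intro t
    simp only [lt_irrefl, dif_neg, not_false_eq_true, dif_pos hK]

end KthOrder

section HOE

variable {ι : Type*} [Fintype ι]

/-- **High-order a priori enclosure test: a solution exists on the whole step and is enclosed
(Nedialkov–Jackson–Pryce 2001, §3).** With Taylor coefficient functions `Φ j` of `f` as in the
module docstring (`Φ 0 = id`; on the open `Ω ⊇ S`, `Φ j` has derivative `Φ' j` with
`Φ' j x (f x) = (j+1) • Φ (j+1) x` for `j < K`; `‖Φ' j‖ ≤ B` on `S`; `Φ K` Lipschitz on `S` with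
`Φ K (S) ⊆ [c, d]`), `0 < K`, `0 ≤ h`: if `∑_{j<K} t^j • Φ j y₀ + t^K • v ∈ S` for all
`t ∈ [0, h]` and `v ∈ [c, d]`, then `y' = f(y)`, `y 0 = y₀` has a solution on `[0, h]` with
`y t = ∑_{j<K} t^j • Φ j y₀ + t^K • v_t`, `v_t ∈ [c, d]` (so `y t ∈ S`) for every `t ∈ [0, h]`.
[cite: NedialkovJacksonPryce2001, §3 (HOE existence test)] -/
theorem exists_solution_of_highOrderEnclosure {f : (ι → ℝ) → ι → ℝ}
    {Φ : ℕ → (ι → ℝ) → ι → ℝ} {Φ' : ℕ → (ι → ℝ) → ((ι → ℝ) →L[ℝ] (ι → ℝ))} {Ω S : Set (ι → ℝ)}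
    {K : ℕ} (hK : 0 < K) {L : ℝ≥0} {B : ℝ} {c d y₀ : ι → ℝ} {h : ℝ} (hSΩ : S ⊆ Ω)
    (hΦ0 : ∀ x, Φ 0 x = x) (hder : ∀ j < K, ∀ x ∈ Ω, HasFDerivAt (Φ j) (Φ' j x) x)
    (hrec : ∀ j < K, ∀ x ∈ Ω, Φ' j x (f x) = ((j : ℝ) + 1) • Φ (j + 1) x)
    (hbd : ∀ j < K, ∀ x ∈ S, ‖Φ' j x‖ ≤ B) (hlipK : LipschitzOnWith L (Φ K) S) (hcd : c ≤ d)
    (hKS : MapsTo (Φ K) S (Icc c d)) (hh : 0 ≤ h)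
    (hincl : ∀ t ∈ Icc 0 h, ∀ v ∈ Icc c d,
      (∑ j ∈ Finset.range K, t ^ j • Φ j y₀) + t ^ K • v ∈ S) :
    ∃ y : ℝ → ι → ℝ, y 0 = y₀ ∧ (∀ t ∈ Icc 0 h, HasDerivWithinAt y (f (y t)) (Icc 0 h) t) ∧
      ∀ t ∈ Icc 0 h, y t ∈ S ∧ ∃ v ∈ Icc c d,
        y t = (∑ j ∈ Finset.range K, t ^ j • Φ j y₀) + t ^ K • v := by
  classical
  -- (A) McShane extension of `Φ K |S`, clamped into the box `[c, d]`
  obtain ⟨g₁, hg₁K, hg₁eq⟩ := hlipK.extend_pi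
  set G : (ι → ℝ) → ι → ℝ := fun x i => max (min (g₁ x i) (d i)) (c i) with hG_def
  have hGF : ∀ x, G x ∈ Icc c d := fun x =>
    ⟨fun i => le_max_right _ _, fun i => max_le ((min_le_right _ _)) (hcd i)⟩
  have hGS : ∀ x ∈ S, G x = Φ K x := by
    intro x hx
    have hfx : Φ K x ∈ Icc c d := hKS hx
    funext i
    have h1 : g₁ x i = Φ K x i := by rw [← hg₁eq hx]
    simp only [hG_def, h1, min_eq_left (hfx.2 i), max_eq_left (hfx.1 i)]
  have hGlip : LipschitzWith L G := by
    refine LipschitzWith.of_dist_le_mul fun x y => (dist_pi_le_iff (by positivity)).2 fun i => ?_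
    have h1 : dist (g₁ x i) (g₁ y i) ≤ L * dist x y :=
      (dist_le_pi_dist (g₁ x) (g₁ y) i).trans (hg₁K.dist_le_mul x y)
    refine le_trans ?_ h1
    rw [Real.dist_eq, Real.dist_eq]
    calc |max (min (g₁ x i) (d i)) (c i) - max (min (g₁ y i) (d i)) (c i)|
        ≤ |min (g₁ x i) (d i) - min (g₁ y i) (d i)| := abs_max_sub_max_le_abs _ _ _
      _ ≤ max |g₁ x i - g₁ y i| |d i - d i| := abs_min_sub_min_le_max _ _ _ _
      _ = |g₁ x i - g₁ y i| := by simp [abs_nonneg]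
  -- (B) the `K`-th order equation `u⁽ᴷ⁾ = K! G(u)` with jets `u⁽ʲ⁾(0) = j! Φ j y₀`
  obtain ⟨D, hD0, hD, hDK⟩ :=
    exists_chain_of_lipschitz hGlip hK (fun j => (j ! : ℝ) • Φ j y₀)
  have hDh : ∀ i < K, ∀ t ∈ Icc 0 h, HasDerivWithinAt (D i) (D (i + 1) t) (Icc 0 h) t :=
    fun i hi t ht => (hD i hi t ht.1).mono fun s hs => hs.1
  have hu0 : D 0 0 = y₀ := by rw [hD0 0 hK]; simp [hΦ0]
  -- (C) the Taylor enclosure of `u = D 0`: `u t = ∑ t^j Φ j y₀ + t^K v`, `v ∈ [c, d]`, so `u t ∈ S`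
  have hencl : ∀ t ∈ Icc 0 h, ∃ v ∈ Icc c d,
      D 0 t = (∑ j ∈ Finset.range K, t ^ j • Φ j y₀) + t ^ K • v := by
    intro t ht
    have hkf : (K ! : ℝ) ≠ 0 := by positivity
    obtain ⟨v, hv, hvt⟩ := taylorCoeff_enclosure K (D := D) (convex_Icc c d) isClosed_Icc (h := h)
      hDh (fun s hs => by rw [hDK s, inv_smul_smul₀ hkf]; exact hGF _) ht
    refine ⟨v, hv, ?_⟩
    rw [hvt]
    congr 1
    refine Finset.sum_congr rfl fun m hm => ?_
    rw [hD0 m (Finset.mem_range.1 hm), inv_smul_smul₀ (by positivity)]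
  have huS : ∀ t ∈ Icc 0 h, D 0 t ∈ S := fun t ht => by
    obtain ⟨v, hv, hvt⟩ := hencl t ht
    rw [hvt]
    exact hincl t ht v hv
  -- (D) the jets match the Taylor coefficients along `u`: `D j t = j! • Φ j (u t)` (Gronwall)
  have hΦ1 : ∀ x ∈ Ω, Φ 1 x = f x := by
    intro x hx
    have hid : HasFDerivAt (Φ 0) (ContinuousLinearMap.id ℝ (ι → ℝ)) x := by
      have : Φ 0 = id := funext hΦ0
      rw [this]
      exact hasFDerivAt_id x
    have huniq : Φ' 0 x = ContinuousLinearMap.id ℝ (ι → ℝ) := (hder 0 hK x hx).unique hid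
    have := hrec 0 hK x hx
    rw [huniq] at this
    simpa using this.symm
  set e : ℕ → ℝ → ι → ℝ := fun j t => D j t - (j ! : ℝ) • Φ j (D 0 t) with he_def
  have he0 : ∀ j < K, e j 0 = 0 := fun j hj => by
    simp only [he_def, hD0 j hj, hu0, sub_self]
  have heK : ∀ t ∈ Icc 0 h, e K t = 0 := fun t ht => by
    simp only [he_def, hDK t, hGS _ (huS t ht), sub_self]
  have hederiv : ∀ j, 1 ≤ j → j < K → ∀ t ∈ Icc 0 h,
      HasDerivWithinAt (e j) (e (j + 1) t - (j ! : ℝ) • Φ' j (D 0 t) (e 1 t)) (Icc 0 h) t := by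
    intro j hj1 hjK t ht
    have hu := hDh 0 hK t ht
    have hcomp : HasDerivWithinAt (fun s => Φ j (D 0 s)) (Φ' j (D 0 t) (D 1 t)) (Icc 0 h) t :=
      (hder j hjK (D 0 t) (hSΩ (huS t ht))).comp_hasDerivWithinAt t hu
    have h1 := (hDh j hjK t ht).sub (hcomp.const_smul (j ! : ℝ))
    refine h1.congr_deriv ?_
    have hrecj : Φ' j (D 0 t) (f (D 0 t)) = ((j : ℝ) + 1) • Φ (j + 1) (D 0 t) :=
      hrec j hjK (D 0 t) (hSΩ (huS t ht))
    have hf1 : Φ 1 (D 0 t) = f (D 0 t) := hΦ1 _ (hSΩ (huS t ht))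
    simp only [he_def]
    rw [Nat.factorial_one, Nat.cast_one, one_smul, map_sub, hf1, hrecj, Nat.factorial_succ,
      Nat.cast_mul, Nat.cast_add, Nat.cast_one, smul_sub, smul_smul]
    module
  have he1 : ∀ t ∈ Icc 0 h, e 1 t = 0 := by
    rcases Nat.lt_or_ge 1 K with hK2 | hK1
    · -- `K ≥ 2`: Gronwall for the vector `(e 1, …, e (K-1))`
      have hKm : 0 < K - 1 := by omega
      set Ev : ℝ → Fin (K - 1) → ι → ℝ := fun t j => e ((j : ℕ) + 1) t with hEv
      set Ev' : ℝ → Fin (K - 1) → ι → ℝ := fun t j =>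
        e ((j : ℕ) + 2) t - (((j : ℕ) + 1)! : ℝ) • Φ' ((j : ℕ) + 1) (D 0 t) (e 1 t) with hEv'
      have hEvd : ∀ t ∈ Icc 0 h, HasDerivWithinAt Ev (Ev' t) (Icc 0 h) t := by
        intro t ht
        refine hasDerivWithinAt_pi.2 fun j => ?_
        have := hederiv ((j : ℕ) + 1) (by omega) (by omega) t ht
        simpa [hEv, hEv', add_assoc] using this
      have hB0 : 0 ≤ B := (norm_nonneg _).trans (hbd 0 hK y₀ (hu0 ▸ huS 0 ⟨le_rfl, hh⟩))
      have hbound : ∀ t ∈ Ico 0 h, ‖Ev' t‖ ≤ (1 + (K ! : ℝ) * B) * ‖Ev t‖ + 0 := by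
        intro t ht
        have ht' : t ∈ Icc 0 h := Ico_subset_Icc_self ht
        rw [add_zero]
        refine (pi_norm_le_iff_of_nonneg (by positivity)).2 fun j => ?_
        have hnext : ‖e ((j : ℕ) + 2) t‖ ≤ ‖Ev t‖ := by
          by_cases hj : (j : ℕ) + 2 < K
          · have := norm_le_pi_norm (Ev t) ⟨(j : ℕ) + 1, by omega⟩
            simpa [hEv, add_assoc] using this
          · have hjK : (j : ℕ) + 2 = K := by omega
            rw [hjK, heK t ht', norm_zero]
            exact norm_nonneg _
        have hone : ‖e 1 t‖ ≤ ‖Ev t‖ := by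
          have := norm_le_pi_norm (Ev t) ⟨0, hKm⟩
          simpa [hEv] using this
        have hfac : (((j : ℕ) + 1)! : ℝ) ≤ (K ! : ℝ) := by
          exact_mod_cast Nat.factorial_le (by omega)
        have hΦ'b : ‖Φ' ((j : ℕ) + 1) (D 0 t)‖ ≤ B := hbd _ (by omega) _ (huS t ht')
        calc ‖Ev' t j‖ = ‖e ((j : ℕ) + 2) t - (((j : ℕ) + 1)! : ℝ) • Φ' ((j : ℕ) + 1) (D 0 t) (e 1 t)‖ := by
              rfl
          _ ≤ ‖e ((j : ℕ) + 2) t‖ + ‖(((j : ℕ) + 1)! : ℝ) • Φ' ((j : ℕ) + 1) (D 0 t) (e 1 t)‖ :=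
              norm_sub_le _ _
          _ ≤ ‖Ev t‖ + (K ! : ℝ) * B * ‖Ev t‖ := by
              refine add_le_add hnext ?_
              rw [norm_smul, Real.norm_of_nonneg (by positivity)]
              calc (((j : ℕ) + 1)! : ℝ) * ‖Φ' ((j : ℕ) + 1) (D 0 t) (e 1 t)‖
                  ≤ (((j : ℕ) + 1)! : ℝ) * (‖Φ' ((j : ℕ) + 1) (D 0 t)‖ * ‖e 1 t‖) :=
                    mul_le_mul_of_nonneg_left (ContinuousLinearMap.le_opNorm _ _) (by positivity)
                _ ≤ (K ! : ℝ) * (B * ‖Ev t‖) := by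
                    refine mul_le_mul hfac ?_ (by positivity) (by positivity)
                    exact mul_le_mul hΦ'b hone (norm_nonneg _) hB0
                _ = (K ! : ℝ) * B * ‖Ev t‖ := by ring
          _ = (1 + (K ! : ℝ) * B) * ‖Ev t‖ := by ring
      have hEvc : ContinuousOn Ev (Icc 0 h) := fun t ht => (hEvd t ht).continuousWithinAt
      have hnhds : ∀ s ∈ Ico (0 : ℝ) h, Icc 0 h ∈ 𝓝[≥] s := fun s hs =>
        mem_of_superset (Icc_mem_nhdsGE hs.2) (Icc_subset_Icc_left hs.1)
      have hEv0 : ‖Ev 0‖ ≤ 0 := by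
        have : Ev 0 = 0 := funext fun j => he0 _ (by omega)
        rw [this, norm_zero]
      have hgr := norm_le_gronwallBound_of_norm_deriv_right_le (f := Ev) (f' := Ev') (a := 0)
        (b := h) hEvc (fun s hs => (hEvd s (Ico_subset_Icc_self hs)).mono_of_mem_nhdsWithin
          (hnhds s hs)) hEv0 hbound
      intro t ht
      have := hgr t ht
      rw [gronwallBound_ε0_δ0] at this
      have hEvt : Ev t = 0 := norm_le_zero_iff.1 this
      have := congr_fun hEvt ⟨0, hKm⟩
      simpa [hEv] using this
    · -- `K = 1`
      have hK1' : K = 1 := le_antisymm hK1 hK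
      intro t ht
      rw [← hK1']
      exact heK t ht
  -- (E) conclusion
  refine ⟨D 0, hu0, fun t ht => ?_, fun t ht => ⟨huS t ht, hencl t ht⟩⟩
  have hu := hDh 0 hK t ht
  have hD1 : D 1 t = f (D 0 t) := by
    have := he1 t ht
    simp only [he_def, Nat.factorial_one, Nat.cast_one, one_smul, sub_eq_zero] at this
    rw [this, hΦ1 _ (hSΩ (huS t ht))]
  rw [hD1] at hu
  exact hu

/-- **High-order a priori enclosure test: every solution is enclosed.** Under the test of
`exists_solution_of_highOrderEnclosure`, if `f` is moreover Lipschitz on every bounded set, then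
EVERY solution `z` of `z' = f(z)` on `[0, h]` with `z 0 = y₀` satisfies
`z t = ∑_{j<K} t^j • Φ j y₀ + t^K • v_t`, `v_t ∈ [c, d]`, in particular `z t ∈ S`, for all
`t ∈ [0, h]` (existence AND uniqueness of the solution in the a priori enclosure).
[cite: NedialkovJacksonPryce2001, §3 (HOE existence test)] -/
theorem solution_mem_of_highOrderEnclosure {f : (ι → ℝ) → ι → ℝ}
    {Φ : ℕ → (ι → ℝ) → ι → ℝ} {Φ' : ℕ → (ι → ℝ) → ((ι → ℝ) →L[ℝ] (ι → ℝ))} {Ω S : Set (ι → ℝ)}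
    {K : ℕ} (hK : 0 < K) {L : ℝ≥0} {B : ℝ} {c d y₀ : ι → ℝ} {h : ℝ} (hSΩ : S ⊆ Ω)
    (hΦ0 : ∀ x, Φ 0 x = x) (hder : ∀ j < K, ∀ x ∈ Ω, HasFDerivAt (Φ j) (Φ' j x) x)
    (hrec : ∀ j < K, ∀ x ∈ Ω, Φ' j x (f x) = ((j : ℝ) + 1) • Φ (j + 1) x)
    (hbd : ∀ j < K, ∀ x ∈ S, ‖Φ' j x‖ ≤ B) (hlipK : LipschitzOnWith L (Φ K) S) (hcd : c ≤ d)
    (hKS : MapsTo (Φ K) S (Icc c d)) (hh : 0 ≤ h)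
    (hincl : ∀ t ∈ Icc 0 h, ∀ v ∈ Icc c d,
      (∑ j ∈ Finset.range K, t ^ j • Φ j y₀) + t ^ K • v ∈ S)
    (hloc : ∀ ρ : ℝ, ∃ K' : ℝ≥0, LipschitzOnWith K' f (closedBall 0 ρ)) {z : ℝ → ι → ℝ}
    (hz0 : z 0 = y₀) (hz : ∀ t ∈ Icc 0 h, HasDerivWithinAt z (f (z t)) (Icc 0 h) t) {t : ℝ}
    (ht : t ∈ Icc 0 h) :
    z t ∈ S ∧ ∃ v ∈ Icc c d, z t = (∑ j ∈ Finset.range K, t ^ j • Φ j y₀) + t ^ K • v := by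
  obtain ⟨y, hy0, hy, hyS⟩ :=
    exists_solution_of_highOrderEnclosure hK hSΩ hΦ0 hder hrec hbd hlipK hcd hKS hh hincl
  have hyc : ContinuousOn y (Icc 0 h) := fun s hs => (hy s hs).continuousWithinAt
  have hzc : ContinuousOn z (Icc 0 h) := fun s hs => (hz s hs).continuousWithinAt
  obtain ⟨Cy, hCy⟩ := isCompact_Icc.exists_bound_of_continuousOn hyc
  obtain ⟨Cz, hCz⟩ := isCompact_Icc.exists_bound_of_continuousOn hzc
  obtain ⟨K', hK'⟩ := hloc (max Cy Cz)
  have hnhds : ∀ s ∈ Ico (0 : ℝ) h, Icc 0 h ∈ 𝓝[≥] s := fun s hs =>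
    mem_of_superset (Icc_mem_nhdsGE hs.2) (Icc_subset_Icc_left hs.1)
  have hEq : EqOn y z (Icc 0 h) :=
    ODE_solution_unique_of_mem_Icc_right (v := fun _ => f) (s := fun _ => closedBall 0 (max Cy Cz))
      (K := K') (fun _ _ => hK') hyc
      (fun s hs => (hy s (Ico_subset_Icc_self hs)).mono_of_mem_nhdsWithin (hnhds s hs))
      (fun s hs => mem_closedBall_zero_iff.2 ((hCy s (Ico_subset_Icc_self hs)).trans (le_max_left _ _)))
      hzc
      (fun s hs => (hz s (Ico_subset_Icc_self hs)).mono_of_mem_nhdsWithin (hnhds s hs))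
      (fun s hs => mem_closedBall_zero_iff.2 ((hCz s (Ico_subset_Icc_self hs)).trans (le_max_right _ _)))
      (hy0.trans hz0.symm)
  rw [← hEq ht]
  exact hyS t ht

/-- **The step form of the high-order enclosure test** (a box `W` of initial values, as a
validated integrator applies it per step: `W + ∑_{1≤j<K} [0,h]^j f^[j](W) + [0,h]^K f^[K](S) ⊆ S`
implies the pointwise hypothesis below for every `y₀ ∈ W`). For every `y₀ ∈ W`: a solution of
`y' = f(y)`, `y(0) = y₀` exists on `[0, h]`, and (for `f` Lipschitz on bounded sets) every such
solution satisfies `y t ∈ ∑_{j<K} t^j • Φ j y₀ + t^K • [c, d] ⊆ S` on `[0, h]`.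
[cite: NedialkovJacksonPryce2001, §3 (HOE existence test)] -/
theorem highOrderEnclosure_step {f : (ι → ℝ) → ι → ℝ}
    {Φ : ℕ → (ι → ℝ) → ι → ℝ} {Φ' : ℕ → (ι → ℝ) → ((ι → ℝ) →L[ℝ] (ι → ℝ))} {Ω S W : Set (ι → ℝ)}
    {K : ℕ} (hK : 0 < K) {L : ℝ≥0} {B : ℝ} {c d : ι → ℝ} {h : ℝ} (hSΩ : S ⊆ Ω)
    (hΦ0 : ∀ x, Φ 0 x = x) (hder : ∀ j < K, ∀ x ∈ Ω, HasFDerivAt (Φ j) (Φ' j x) x)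
    (hrec : ∀ j < K, ∀ x ∈ Ω, Φ' j x (f x) = ((j : ℝ) + 1) • Φ (j + 1) x)
    (hbd : ∀ j < K, ∀ x ∈ S, ‖Φ' j x‖ ≤ B) (hlipK : LipschitzOnWith L (Φ K) S) (hcd : c ≤ d)
    (hKS : MapsTo (Φ K) S (Icc c d)) (hh : 0 ≤ h)
    (hloc : ∀ ρ : ℝ, ∃ K' : ℝ≥0, LipschitzOnWith K' f (closedBall 0 ρ))
    (hincl : ∀ y₀ ∈ W, ∀ t ∈ Icc 0 h, ∀ v ∈ Icc c d,
      (∑ j ∈ Finset.range K, t ^ j • Φ j y₀) + t ^ K • v ∈ S)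
    {y₀ : ι → ℝ} (hy₀ : y₀ ∈ W) :
    (∃ y : ℝ → ι → ℝ, y 0 = y₀ ∧ ∀ t ∈ Icc 0 h, HasDerivWithinAt y (f (y t)) (Icc 0 h) t) ∧
      ∀ z : ℝ → ι → ℝ, z 0 = y₀ → (∀ t ∈ Icc 0 h, HasDerivWithinAt z (f (z t)) (Icc 0 h) t) →
        ∀ t ∈ Icc 0 h, z t ∈ S ∧
          ∃ v ∈ Icc c d, z t = (∑ j ∈ Finset.range K, t ^ j • Φ j y₀) + t ^ K • v := by
  refine ⟨?_, fun z hz0 hz t ht => solution_mem_of_highOrderEnclosure hK hSΩ hΦ0 hder hrec hbd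
    hlipK hcd hKS hh (hincl y₀ hy₀) hloc hz0 hz ht⟩
  obtain ⟨y, hy0, hy, -⟩ :=
    exists_solution_of_highOrderEnclosure hK hSΩ hΦ0 hder hrec hbd hlipK hcd hKS hh (hincl y₀ hy₀)
  exact ⟨y, hy0, hy⟩

end HOE

end Literature.Analysis.ODE

end
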